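import Literature.Analysis.FluidPDE.SelfSimilarLiouville
import Literature.Analysis.FluidPDE.KNSSThm53OfWindow
import Literature.Analysis.FluidPDE.KNSSThm52SliceBridge
import HarnessLib

/-!
# Lei–Ren–Zhang 2019, §4: the swirl supremum is approached at radial infinity (proof)

Analysis/FluidPDE proofs file (everything proved; no definitions, no named facts), sibling of
`Literature.Analysis.FluidPDE.SelfSimilarLiouville`, discharging the named fact
`Literature.Analysis.FluidPDE.leiRenZhang2019_swirl_sup_at_infinity` (Z. Lei, X. Ren, Q. S. Zhang,
*On ancient periodic solutions to axially-symmetric Navier–Stokes equations*, arXiv:1902.11229,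
§1 p. 4: "It will be shown in Section 4 that if `v` is any bounded ancient solution such that `Γ`
is bounded, then `lim sup_{r→∞} Γ = sup Γ`"; proved in §4, p. 10, as the first observation of the
proof of Theorem 1.2):

* `leiRenZhang2019_swirl_sup_at_infinity_holds : leiRenZhang2019_swirl_sup_at_infinity`.

## The printed argument and the argument formalised here

Print (§4 p. 10): if `lim sup_{r→∞, z, t} |Γ| < sup |Γ|`, a near-supremum sequence has bounded
`r_i`; the time translates `Γ(·, · + t_i)` converge in `C^{2,1}_{loc}` (KNSS regularity of bounded
ancient mild solutions) to a bounded ancient solution `Γ_∞` of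
`ΔΓ_∞ − b̄∇Γ_∞ − (2/r)∂ᵣΓ_∞ − ∂ₜΓ_∞ = 0` attaining a non-zero interior maximum off the axis
(`|Γ| ≤ r‖v‖_∞` keeps near-maxima off the axis), hence constant by the strong maximum principle,
contradicting `Γ_∞ = 0` on the axis. The ingredients are (a) KNSS 2009, §4 regularity, (b)
compactness of translates, (c) the strong maximum principle, (d) `Γ = 0` on the axis.

Here (a) and (d) are used as printed, and **(b)+(c) are replaced by the quantitative strong
maximum principle, KNSS 2009, Lemma 2.1** ("stability of the strong maximum principle", `δ`
uniform in the drift bound), which the tree has proved (`KNSS2009_lemma21_holds`,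
`KNSSLemma21Proof`): no limit needs to be extracted, Lemma 2.1 is applied directly to a translate
of `Γ` on a fixed annular cylinder away from the axis (`exists_far_gt_of_forall_exists_gt`). This is
the same mechanism (a near-maximum at an interior point off the axis spreads to a region where
`|Γ|` is known to be small) in its effective form, exactly as KNSS use Lemma 2.1 in the proof of
their Theorem 5.3 (`IsKNSSSwirlPair.exists_rescale_ge`, `KNSSSwirlSupNonpos`).

## Structure

1. `exists_boundedWeak_axisymmetric_modification` — the bridge from the tree's duality-form class
   (bounded ancient mild solutions with measurable, pointwise axisymmetric slices) to KNSS's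
   bounded weak solutions, up to an axial drift `d(t) e_z` on every slice (steps (1)–(4) of
   `knss_axisymmetric_no_swirl_of_KNSS2009`, `KNSSThm52SliceBridge`, verbatim).
2. `exists_knss_representative_of_isAxisymmetric` — KNSS §4 for the modification
   (`KNSS2009_regularity_axisymmetric_swirl_holds`) and the upgrade from a.e. `t` to every `t`
   (continuity of the solenoidal pairings, the annihilator lemma): `u(t) = U(t) + κ(t)e_z` a.e.
   for every `t < 0`, so `swirl (u t) = swirl (U t)` a.e. for every `t < 0`.
3. `exists_far_gt_of_forall_exists_gt`, `exists_far_abs_gt_of_forall_exists_abs_gt` — the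
   maximum-principle step for a `C²` scalar solving the swirl equation with bounded drift.
4. `leiRenZhang2019_swirl_sup_at_infinity_holds` — assembly: positive-measure superlevel sets of
   `|swirl (u t)|` are those of the continuous `|swirl (U t)|`, which are open.

## References

* Z. Lei, X. Ren, Q. S. Zhang, *On ancient periodic solutions to axially-symmetric Navier–Stokes
  equations*, arXiv:1902.11229 (2019), §1 p. 4 and §4 p. 10 (published part: Sci. Sin. Math. 51
  (2021) 971–984). [LeiRenZhang2019]
* G. Koch, N. Nadirashvili, G. Seregin, V. Šverák, *Liouville theorems for the Navier–Stokes
  equations and applications*, Acta Math. 203 (2009) 83–105 = arXiv:0709.3599, Lemma 2.1 (p. 5),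
  Lemma 3.1 (p. 7), §4 (4.6)–(4.8) (p. 8), (5.10) and the proof of Theorem 5.3 (p. 10).
  [KochNadirashviliSereginSverak2009]
* Q. S. Zhang, X. Pan, *A review of results on axially symmetric Navier–Stokes equations*, Anal.
  Theory Appl. 38 (2022) = arXiv:2101.04905, p. 12. [ZhangPan2022]
-/

noncomputable section

open MeasureTheory Set Function Filter TopologicalSpace InnerProductSpace
open _root_.Topology
open scoped RealInnerProductSpace Laplacian ContDiff NNReal ENNReal

namespace Literature.Analysis.FluidPDE


/-! ### Translations along the axis -/

section Translation

/-- `e_r(z̄ e_z + y) = e_r(y)`: translations along the axis do not turn the radial direction.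
[folklore] -/
theorem eR_smul_eZ_add (z : ℝ) (y : EuclideanSpace ℝ (Fin 3)) : eR (z • eZ + y) = eR y := by
  simpa only [one_smul] using eR_smul_eZ_add_smul z one_pos y

end Translation

/-! ### The maximum-principle step: a positive supremum of the swirl is approached far from the axis -/

section Core

variable {f : ℝ → EuclideanSpace ℝ (Fin 3) → ℝ} {b : ℝ → EuclideanSpace ℝ (Fin 3) → EuclideanSpace ℝ (Fin 3)} {C₀ B M ℓ : ℝ}

/-- **Lei–Ren–Zhang 2019, §4 (arXiv:1902.11229, p. 10), the maximum-principle step, one-sided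
form.** Let `f : (−∞, 0) × ℝ³ → ℝ` have `C²` slices with `∇f`, `Δf` jointly continuous, satisfy
`|f| ≤ C₀ r` (so `f = 0` on the axis) and solve the swirl equation
`∂ₜf + b·∇f + (2/r)∂ᵣf = Δf` off the axis (time-integrated form) with a bounded measurable drift
`b`. If `M > ℓ ≥ 0` bounds `|f|` and `f` takes values above `M − η` for every `η > 0`, then `f`
takes values above `ℓ` beyond every radius `R`. In print this is obtained from a `C^{2,1}_{loc}`
limit of time translates and the strong maximum principle ("`Γ_∞` reaches nonzero interior
maximum away from the `z` axis … Hence `Γ_∞` is a nonzero constant by the maximum principle. This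
contradicts with the fact that `Γ_∞ = 0` at the `z` axis"); here the compactness step is replaced
by the quantitative form of the strong maximum principle, KNSS 2009, Lemma 2.1
(`KNSS2009_lemma21_holds`), applied on the annular cylinder
`Ω = {r₀/2 < r < R'+3, |z| < 3}` (`r₀ = M/(2C₀)`, `R' = max R r₀`) to a translate of `f` putting a
point with `f > M(1 − δ)` into `K = {r₀ ≤ r ≤ R', |z| ≤ 1}` at the final time: if `f ≤ ℓ` held
beyond radius `R`, Lemma 2.1 would give `f ≥ M(1 − ε) = (M + ℓ)/2 > ℓ` on
`{R'+1 < r < R'+2, |z| < 1}`, a contradiction. [cite: LeiRenZhang2019, §4 p. 10 (proof of Thm 1.2, first observation)] -/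
theorem exists_far_gt_of_forall_exists_gt
    (hf : ∀ t < 0, ContDiff ℝ 2 (f t))
    (hDf : ContinuousOn (fun p : ℝ × EuclideanSpace ℝ (Fin 3) => fderiv ℝ (f p.1) p.2) (Iio 0 ×ˢ univ))
    (hΔf : ContinuousOn (fun p : ℝ × EuclideanSpace ℝ (Fin 3) => (Δ (f p.1)) p.2) (Iio 0 ×ˢ univ))
    (haxis : ∀ t < 0, ∀ x, |f t x| ≤ cylRadius x * C₀)
    (hb : Measurable (uncurry b)) (hB : ∀ t < 0, ∀ x, ‖b t x‖ ≤ B)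
    (heq : ∀ x, cylRadius x ≠ 0 → ∀ s t : ℝ, s ≤ t → t < 0 →
      f t x - f s x = ∫ τ in s..t, ((Δ (f τ)) x - fderiv ℝ (f τ) x (b τ x) -
        2 / cylRadius x * partialDeriv (eR x) (f τ) x))
    (hM : ∀ t < 0, ∀ x, |f t x| ≤ M) (hℓ : 0 ≤ ℓ) (hℓM : ℓ < M)
    (happr : ∀ η > 0, ∃ t < 0, ∃ x, M - η < f t x) (R : ℝ) :
    ∃ t < 0, ∃ x, R ≤ cylRadius x ∧ ℓ < f t x := by
  by_contra H
  push Not at H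
  have hMpos : 0 < M := lt_of_le_of_lt hℓ hℓM
  -- `C₀ > 0`: `f` takes values `> M/2 > 0` and `|f| ≤ r C₀`
  have hC₀ : 0 < C₀ := by
    obtain ⟨t₁, ht₁, x₁, hx₁⟩ := happr (M / 2) (by positivity)
    by_contra hle
    push Not at hle
    have h1 : cylRadius x₁ * C₀ ≤ 0 := mul_nonpos_of_nonneg_of_nonpos (cylRadius_nonneg _) hle
    have h2 := haxis t₁ ht₁ x₁
    linarith [le_abs_self (f t₁ x₁)]
  -- near-maximum points are at distance `> r₀` from the axis
  set r₀ : ℝ := M / (2 * C₀) with hr₀_def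
  have hr₀ : 0 < r₀ := by positivity
  set R' : ℝ := max R r₀ with hR'_def
  have hR'R : R ≤ R' := le_max_left _ _
  have hR'r : r₀ ≤ R' := le_max_right _ _
  -- the configuration of Lemma 2.1
  set Ω : Set (EuclideanSpace ℝ (Fin 3)) := annCyl (r₀ / 2) (R' + 3) 3 with hΩ_def
  set Ω' : Set (EuclideanSpace ℝ (Fin 3)) := annCyl (R' + 1) (R' + 2) 1 with hΩ'_def
  set K : Set (EuclideanSpace ℝ (Fin 3)) := annCylClosed r₀ R' 1 with hK_def
  have hΩo : IsOpen Ω := isOpen_annCyl _ _ _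
  have hΩb : Bornology.IsBounded Ω := isBounded_annCyl _ _ _
  have hΩc : IsConnected Ω := isConnected_annCyl (by positivity) (by linarith) (by norm_num)
  have hcl : closure Ω' ⊆ Ω :=
    (closure_annCyl_subset _ _ _).trans
      (annCylClosed_subset_annCyl (by linarith) (by linarith) (by norm_num))
  have hKc : IsCompact K := isCompact_annCylClosed _ _ _
  have hKΩ : K ⊆ Ω := annCylClosed_subset_annCyl (by linarith) (by linarith) (by norm_num)
  have hΩr : ∀ y ∈ Ω, r₀ / 2 < cylRadius y := fun y hy => hy.1
  set ε : ℝ := (M - ℓ) / (2 * M) with hε_def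
  have hε : 0 < ε := div_pos (by linarith) (by positivity)
  set A : ℝ := B + 4 / r₀ with hA_def
  obtain ⟨δ, hδ, hP⟩ := KNSS2009_lemma21_holds (EuclideanSpace ℝ (Fin 3)) (T := 2) (A := A)
    hΩo hΩb hΩc hcl hKc hKΩ one_pos hε
  -- a near-maximum point: `f(t*, x*) > M - η`, `η ≤ Mδ, M/2, M - ℓ`
  set η : ℝ := min (min (M * δ) (M / 2)) (M - ℓ) with hη_def
  have hη : 0 < η := lt_min (lt_min (by positivity) (by positivity)) (by linarith)
  have hη1 : η ≤ M * δ := (min_le_left _ _).trans (min_le_left _ _)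
  have hη2 : η ≤ M / 2 := (min_le_left _ _).trans (min_le_right _ _)
  have hη3 : η ≤ M - ℓ := min_le_right _ _
  obtain ⟨tstar, htstar, xstar, hnear⟩ := happr η hη
  -- it lies in `r₀ < r < R'`
  have hrx : r₀ < cylRadius xstar := by
    have h1 : M / 2 < cylRadius xstar * C₀ := by
      have := haxis tstar htstar xstar
      linarith [le_abs_self (f tstar xstar)]
    rw [hr₀_def, div_lt_iff₀ (by positivity)]
    nlinarith
  have hrx' : cylRadius xstar < R' := by
    by_contra hge
    push Not at hge
    have := H tstar htstar xstar (hR'R.trans hge)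
    linarith
  -- the translated scalar and drift (Lemma 2.1 lives on `(0, 2] × Ω`)
  set zbar : ℝ := xstar 2 with hzbar
  set t₀ : ℝ := tstar - 2 with ht₀
  set c : EuclideanSpace ℝ (Fin 3) := zbar • eZ with hc_def
  set g : ℝ → EuclideanSpace ℝ (Fin 3) → ℝ := fun s y => f (t₀ + s) (c + y) with hg_def
  set a : ℝ → EuclideanSpace ℝ (Fin 3) → EuclideanSpace ℝ (Fin 3) := fun s y => b (t₀ + s) (c + y) + (2 / cylRadius y) • eR y with ha_def
  have htime : ∀ s ∈ Ioc (0 : ℝ) 2, t₀ + s < 0 := fun s hs => by rw [ht₀]; linarith [hs.2]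
  have hcr : ∀ y : EuclideanSpace ℝ (Fin 3), cylRadius (c + y) = cylRadius y := fun y =>
    SereginSverak2009.cylRadius_smul_eZ_add zbar y
  have hceR : ∀ y : EuclideanSpace ℝ (Fin 3), eR (c + y) = eR y := fun y => eR_smul_eZ_add zbar y
  -- the space–time shift as a continuous map into `(−∞, 0) × ℝ³`
  have hΦc : Continuous fun p : ℝ × EuclideanSpace ℝ (Fin 3) => (t₀ + p.1, c + p.2) := by fun_prop
  have hΦmaps : MapsTo (fun p : ℝ × EuclideanSpace ℝ (Fin 3) => (t₀ + p.1, c + p.2)) (Ioc (0 : ℝ) 2 ×ˢ Ω)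
      (Iio 0 ×ˢ univ) := fun p hp => ⟨htime p.1 hp.1, mem_univ _⟩
  -- (1) the drift is jointly measurable
  have ha_meas : Measurable (uncurry a) := by
    have h1 : Measurable fun p : ℝ × EuclideanSpace ℝ (Fin 3) => b (t₀ + p.1) (c + p.2) := hb.comp hΦc.measurable
    have h2 : Measurable fun p : ℝ × EuclideanSpace ℝ (Fin 3) => (2 / cylRadius p.2) • eR p.2 :=
      ((measurable_const.div continuous_cylRadius.measurable).comp measurable_snd).smul
        (measurable_eR.comp measurable_snd)
    exact h1.add h2
  -- (2) the drift is bounded by `A` on `(0, 2] × Ω`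
  have ha_bd : ∀ s ∈ Ioc (0 : ℝ) 2, ∀ y ∈ Ω, ‖a s y‖ ≤ A := by
    intro s hs y hy
    have hr := hΩr y hy
    have hr0 : 0 < cylRadius y := by linarith
    have h1 : ‖b (t₀ + s) (c + y)‖ ≤ B := hB _ (htime s hs) _
    have h2 : ‖(2 / cylRadius y) • eR y‖ ≤ 4 / r₀ := by
      rw [norm_smul, Real.norm_eq_abs, abs_of_nonneg (by positivity)]
      have h3 : 2 / cylRadius y ≤ 4 / r₀ := by
        rw [div_le_div_iff₀ hr0 hr₀]
        linarith
      have h4 := norm_eR_le_one y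
      calc 2 / cylRadius y * ‖eR y‖ ≤ 4 / r₀ * 1 :=
            mul_le_mul h3 h4 (norm_nonneg _) (by positivity)
        _ = 4 / r₀ := mul_one _
    calc ‖a s y‖ ≤ ‖b (t₀ + s) (c + y)‖ + ‖(2 / cylRadius y) • eR y‖ := norm_add_le _ _
      _ ≤ B + 4 / r₀ := add_le_add h1 h2
      _ = A := rfl
  -- (3) `C²` slices on `Ω`
  have hg_C2 : ∀ s ∈ Ioc (0 : ℝ) 2, ContDiffOn ℝ 2 (g s) Ω := fun s hs =>
    ((hf _ (htime s hs)).comp (contDiff_const.add contDiff_id)).contDiffOn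
  -- (4) `∇g` and `Δg` are jointly continuous on `(0, 2] × Ω`
  have hg_D : ∀ s (y : EuclideanSpace ℝ (Fin 3)), fderiv ℝ (g s) y = fderiv ℝ (f (t₀ + s)) (c + y) := fun s y =>
    fderiv_comp_add_left c
  have hg_Δ : ∀ s (y : EuclideanSpace ℝ (Fin 3)), (Δ (g s)) y = (Δ (f (t₀ + s))) (c + y) := fun s y =>
    laplacian_comp_const_add (f (t₀ + s)) c y
  have hg_cont1 : ContinuousOn (fun p : ℝ × EuclideanSpace ℝ (Fin 3) => fderiv ℝ (g p.1) p.2) (Ioc (0 : ℝ) 2 ×ˢ Ω) := by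
    refine (hDf.comp hΦc.continuousOn hΦmaps).congr fun p _ => ?_
    exact hg_D p.1 p.2
  have hg_cont2 : ContinuousOn (fun p : ℝ × EuclideanSpace ℝ (Fin 3) => (Δ (g p.1)) p.2) (Ioc (0 : ℝ) 2 ×ˢ Ω) := by
    refine (hΔf.comp hΦc.continuousOn hΦmaps).congr fun p _ => ?_
    exact hg_Δ p.1 p.2
  -- (5) the equation on `Ω` with the merged drift `b + (2/r) e_r`
  have hg_eq : ∀ y ∈ Ω, ∀ s t : ℝ, 0 < s → s ≤ t → t ≤ 2 →
      g t y - g s y = ∫ r in s..t, ((Δ (g r)) y - fderiv ℝ (g r) y (a r y)) := by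
    intro y hy s t hs hst ht2
    have hr := hΩr y hy
    have hy0 : cylRadius y ≠ 0 := by linarith
    have hX0 : cylRadius (c + y) ≠ 0 := by rw [hcr]; exact hy0
    have htt : t₀ + t < 0 := htime t ⟨hs.trans_le hst, ht2⟩
    have hsrc := heq (c + y) hX0 (t₀ + s) (t₀ + t) (by linarith) htt
    have hsub := intervalIntegral.integral_comp_add_left (a := s) (b := t)
      (fun τ => (Δ (f τ)) (c + y) - fderiv ℝ (f τ) (c + y) (b τ (c + y)) -
        2 / cylRadius (c + y) * partialDeriv (eR (c + y)) (f τ) (c + y)) t₀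
    show f (t₀ + t) (c + y) - f (t₀ + s) (c + y) = _
    rw [hsrc, ← hsub]
    refine intervalIntegral.integral_congr fun r _ => ?_
    simp only [hg_Δ, hg_D, ha_def, hcr, hceR, partialDeriv_apply, map_add, map_smul, smul_eq_mul]
    ring
  -- (6) `|g| ≤ M` on `(0, 2] × Ω`; the near-maximum sits at `(2, x* - z̄ e_z)`, a point of `K`
  have hg_bd : ∀ s ∈ Ioc (0 : ℝ) 2, ∀ y ∈ Ω, |g s y| ≤ M := fun s hs y _ => hM _ (htime s hs) _
  set y₀ : EuclideanSpace ℝ (Fin 3) := xstar - c with hy₀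
  have hcy₀ : c + y₀ = xstar := by rw [hy₀]; abel
  have hy₀K : y₀ ∈ K := by
    have hr : cylRadius y₀ = cylRadius xstar := by rw [← hcr y₀, hcy₀]
    refine ⟨by rw [hr]; exact hrx.le, by rw [hr]; exact hrx'.le, ?_⟩
    have h2 : y₀ 2 = 0 := by simp [hy₀, hc_def, hzbar, eZ]
    rw [h2, abs_zero]
    exact zero_le_one
  have hnear' : ∃ x ∈ K, M * (1 - δ) ≤ g 2 x := by
    refine ⟨y₀, hy₀K, ?_⟩
    have h2 : g 2 y₀ = f tstar xstar := by
      show f (t₀ + 2) (c + y₀) = f tstar xstar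
      rw [hcy₀, ht₀, sub_add_cancel]
    rw [h2]
    nlinarith
  -- Lemma 2.1: `g ≥ M(1 − ε) = (M + ℓ)/2` on `Ω' × (1, 2)`
  have key := hP ha_meas ha_bd hg_C2 hg_cont1 hg_cont2 hg_eq hMpos hg_bd hnear'
  -- evaluate at `s = 3/2` and `y₁ = (R' + 3/2, 0, 0) ∈ Ω'`, beyond radius `R`: there `g ≤ ℓ`
  set y₁ : EuclideanSpace ℝ (Fin 3) := WithLp.toLp 2 ![R' + 3 / 2, 0, 0] with hy₁
  have hnn : 0 ≤ R' + 3 / 2 := by linarith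
  have hy₁0 : y₁ 0 = R' + 3 / 2 := by simp [hy₁]
  have hy₁1 : y₁ 1 = 0 := by simp [hy₁]
  have hy₁2 : y₁ 2 = 0 := by simp [hy₁]
  have hy₁r : cylRadius y₁ = R' + 3 / 2 := by
    rw [cylRadius, hy₁0, hy₁1]
    simp [Real.sqrt_sq hnn]
  have hy₁Ω' : y₁ ∈ Ω' := by
    refine ⟨by rw [hy₁r]; linarith, by rw [hy₁r]; linarith, ?_⟩
    rw [hy₁2, abs_zero]
    exact one_pos
  have h1 := key (3 / 2) ⟨by norm_num, by norm_num⟩ y₁ hy₁Ω'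
  have h2 : g (3 / 2) y₁ ≤ ℓ := by
    show f (t₀ + 3 / 2) (c + y₁) ≤ ℓ
    refine H _ (by rw [ht₀]; linarith) _ ?_
    rw [hcr, hy₁r]
    linarith
  have h3 : M * (1 - ε) = (M + ℓ) / 2 := by
    rw [hε_def]
    field_simp
    ring
  rw [h3] at h1
  linarith

/-- **Lei–Ren–Zhang 2019, §4 (arXiv:1902.11229, p. 10): the supremum of `|Γ|` is approached at
radial infinity**, for a scalar `f` in the class of `exists_far_gt_of_forall_exists_gt` (the
two-sided form: the printed argument "for `|Γ|`" is the one-sided one applied to `Γ` or to `−Γ`,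
which solves the same linear equation). If `M > ℓ` bounds `|f|` and `|f|` takes values above
`M − η` for every `η > 0`, then `|f|` takes values above `ℓ` beyond every radius `R`. [cite: LeiRenZhang2019, §1 p. 4 and §4 p. 10] -/
theorem exists_far_abs_gt_of_forall_exists_abs_gt
    (hf : ∀ t < 0, ContDiff ℝ 2 (f t))
    (hDf : ContinuousOn (fun p : ℝ × EuclideanSpace ℝ (Fin 3) => fderiv ℝ (f p.1) p.2) (Iio 0 ×ˢ univ))
    (hΔf : ContinuousOn (fun p : ℝ × EuclideanSpace ℝ (Fin 3) => (Δ (f p.1)) p.2) (Iio 0 ×ˢ univ))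
    (haxis : ∀ t < 0, ∀ x, |f t x| ≤ cylRadius x * C₀)
    (hb : Measurable (uncurry b)) (hB : ∀ t < 0, ∀ x, ‖b t x‖ ≤ B)
    (heq : ∀ x, cylRadius x ≠ 0 → ∀ s t : ℝ, s ≤ t → t < 0 →
      f t x - f s x = ∫ τ in s..t, ((Δ (f τ)) x - fderiv ℝ (f τ) x (b τ x) -
        2 / cylRadius x * partialDeriv (eR x) (f τ) x))
    (hM : ∀ t < 0, ∀ x, |f t x| ≤ M) (hℓM : ℓ < M)
    (happr : ∀ η > 0, ∃ t < 0, ∃ x, M - η < |f t x|) (R : ℝ) :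
    ∃ t < 0, ∃ x, R ≤ cylRadius x ∧ ℓ < |f t x| := by
  rcases lt_or_ge ℓ 0 with hℓ | hℓ
  · -- a negative level is exceeded everywhere; pick any point beyond radius `R`
    set y₁ : EuclideanSpace ℝ (Fin 3) := WithLp.toLp 2 ![|R| + 1, 0, 0] with hy₁
    have hnn : 0 ≤ |R| + 1 := by positivity
    have hy₁0 : y₁ 0 = |R| + 1 := by simp [hy₁]
    have hy₁1 : y₁ 1 = 0 := by simp [hy₁]
    have hy₁r : cylRadius y₁ = |R| + 1 := by
      rw [cylRadius, hy₁0, hy₁1]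
      simp [Real.sqrt_sq hnn]
    refine ⟨-1, by norm_num, y₁, ?_, hℓ.trans_le (abs_nonneg _)⟩
    rw [hy₁r]
    linarith [le_abs_self R]
  by_cases hplus : ∀ η > 0, ∃ t < 0, ∃ x, M - η < f t x
  · obtain ⟨t, ht, x, hx, hlt⟩ :=
      exists_far_gt_of_forall_exists_gt hf hDf hΔf haxis hb hB heq hM hℓ hℓM hplus R
    exact ⟨t, ht, x, hx, hlt.trans_le (le_abs_self _)⟩
  -- otherwise the supremum of `|f|` is approached by `-f`
  push Not at hplus
  obtain ⟨η₁, hη₁, hle⟩ := hplus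
  have hminus : ∀ η > 0, ∃ t < 0, ∃ x, M - η < -f t x := by
    intro η hη
    obtain ⟨t, ht, x, hx⟩ := happr (min η η₁) (lt_min hη hη₁)
    refine ⟨t, ht, x, ?_⟩
    have h1 := hle t ht x
    have h2 : min η η₁ ≤ η := min_le_left _ _
    have h3 : min η η₁ ≤ η₁ := min_le_right _ _
    have h4 : f t x < |f t x| := by linarith
    have h5 : |f t x| = -f t x := by
      rcases abs_choice (f t x) with h | h
      · linarith
      · exact h
    linarith
  -- the hypotheses for `-f` (the equation is linear and homogeneous)
  have hneg : ∀ t, (fun x => -f t x) = -(f t) := fun t => rfl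
  have hf' : ∀ t < 0, ContDiff ℝ 2 fun x => -f t x := fun t ht => (hf t ht).neg
  have hDf' : ContinuousOn (fun p : ℝ × EuclideanSpace ℝ (Fin 3) => fderiv ℝ (fun x => -f p.1 x) p.2) (Iio 0 ×ˢ univ) := by
    have : (fun p : ℝ × EuclideanSpace ℝ (Fin 3) => fderiv ℝ (fun x => -f p.1 x) p.2) =
        fun p => -fderiv ℝ (f p.1) p.2 := funext fun p => fderiv_fun_neg
    rw [this]
    exact hDf.neg
  have hΔf' : ContinuousOn (fun p : ℝ × EuclideanSpace ℝ (Fin 3) => (Δ fun x => -f p.1 x) p.2) (Iio 0 ×ˢ univ) := by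
    have : (fun p : ℝ × EuclideanSpace ℝ (Fin 3) => (Δ fun x => -f p.1 x) p.2) = fun p => -(Δ (f p.1)) p.2 :=
      funext fun p => by rw [hneg, InnerProductSpace.laplacian_neg]; rfl
    rw [this]
    exact hΔf.neg
  have haxis' : ∀ t < 0, ∀ x, |(-f t x)| ≤ cylRadius x * C₀ := fun t ht x => by
    rw [abs_neg]; exact haxis t ht x
  have hM' : ∀ t < 0, ∀ x, |(-f t x)| ≤ M := fun t ht x => by rw [abs_neg]; exact hM t ht x
  have heq' : ∀ x, cylRadius x ≠ 0 → ∀ s t : ℝ, s ≤ t → t < 0 →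
      (-f t x) - (-f s x) = ∫ τ in s..t, ((Δ fun y => -f τ y) x -
        fderiv ℝ (fun y => -f τ y) x (b τ x) -
        2 / cylRadius x * partialDeriv (eR x) (fun y => -f τ y) x) := by
    intro x hx s t hst ht
    have hint : (fun τ => (Δ fun y => -f τ y) x - fderiv ℝ (fun y => -f τ y) x (b τ x) -
        2 / cylRadius x * partialDeriv (eR x) (fun y => -f τ y) x) =
        fun τ => -((Δ (f τ)) x - fderiv ℝ (f τ) x (b τ x) -
          2 / cylRadius x * partialDeriv (eR x) (f τ) x) := by
      funext τ
      rw [partialDeriv_apply, partialDeriv_apply, hneg, InnerProductSpace.laplacian_neg,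
        fderiv_neg]
      simp only [Pi.neg_apply, neg_apply]
      ring
    rw [hint, intervalIntegral.integral_neg, ← heq x hx s t hst ht]
    ring
  obtain ⟨t, ht, x, hx, hlt⟩ :=
    exists_far_gt_of_forall_exists_gt hf' hDf' hΔf' haxis' hb hB heq' hM' hℓ hℓM hminus R
  exact ⟨t, ht, x, hx, hlt.trans_le (neg_le_abs _)⟩

end Core


/-! ### The bridge: from the duality-form class to KNSS's bounded weak solutions -/

section Bridge

/-- **The duality-form class reduces to print's `L^∞(ℝ³ × (−∞, 0))` up to an axial drift**
(KNSS 2009, §1 p. 3 and §3 p. 7: the spatial constant `b(t)` of a bounded weak solution is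
bounded measurable; in the tree's duality-form class of bounded ancient mild solutions with
measurable slices it need not be, and this is the only obstruction). For a bounded ancient mild
solution `u` (`ν = 1`) with measurable, pointwise axisymmetric slices there is a jointly
measurable bounded weak solution `v` of Navier–Stokes in `ℝ³ × (−∞, 0)`
(`IsBoundedWeakNSSolutionOn`), axisymmetric as an `L^∞` function, whose every slice `v(t)`,
`t < 0`, is a.e. `u(t) + d(t) e_z` for some real `d(t)`. This is steps (1)–(4) of the proof of
`knss_axisymmetric_no_swirl_of_KNSS2009` (`KNSSThm52SliceBridge`), verbatim: subtract the axial
average against a radial weight to get a jointly measurable modification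
(`IsBoundedAncientMildSolution.exists_modification_sub_average`), make the drift measurable where
the duality identity pins it (honest rational final times, a countable dense family of solenoidal
tests) and replace it by zero where the slice is invariant under vertical translations (the drift
lemma `IsBoundedAncientMildSolution.add_timeConst_smul_of_ae_invariant`), and pass from mild to
weak (`IsBoundedAncientMildSolution.isBoundedWeakNSSolutionOn`). In particular
`swirl (v t) = swirl (u t)` a.e. for every `t < 0` (the swirl does not see axial constants). [cite: KochNadirashviliSereginSverak2009, §1 p. 3 and §3 p. 7 (the constant b(t)); §4 (i)–(ii) p. 8] -/
theorem exists_boundedWeak_axisymmetric_modification {u : ℝ → EuclideanSpace ℝ (Fin 3) → EuclideanSpace ℝ (Fin 3)}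
    (hu : IsBoundedAncientMildSolution 1 u) (hmeas : ∀ t < 0, AEStronglyMeasurable (u t) volume)
    (haxi : ∀ t < 0, IsAxisymmetric (u t)) :
    ∃ v : ℝ → EuclideanSpace ℝ (Fin 3) → EuclideanSpace ℝ (Fin 3), IsBoundedWeakNSSolutionOn (Iio 0) isOpen_Iio 1 v ∧
      (∀ θ : ℝ, ∀ᵐ t ∂((volume : Measure ℝ).restrict (Iio 0)),
        (fun x => v t (rotZ θ x)) =ᵐ[volume] fun x => rotZ θ (v t x)) ∧
      ∀ t < 0, ∃ d : ℝ, v t =ᵐ[volume] fun x => u t x + d • eZ := by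
  obtain ⟨M, hM'⟩ := hu.2
  have hM : ∀ t < 0, ∀ x, ‖u t x‖ ≤ M := fun t ht x => hM' t ht x
  have hM0 : 0 ≤ M := (norm_nonneg _).trans (hM (-1) (by norm_num) 0)
  have hν : (0 : ℝ) < 1 := one_pos
  -- (i) a radial weight and the axial average `c t e_z`
  obtain ⟨g, hg, hg0, hg1, hgrad⟩ := exists_radial_test_weight (E := EuclideanSpace ℝ (Fin 3))
  have hgc : Continuous g := hg.contDiff.continuous
  have hgi : Integrable g := hgc.integrable_of_hasCompactSupport hg.hasCompactSupport
  have hgrot : ∀ y, g (rotZ Real.pi y) = g y := fun y => hgrad _ _ (norm_rotZ _ _)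
  set c : ℝ → ℝ := fun t => ∫ y, g y * u t y 2 with hc_def
  have havg : ∀ t < 0, ∫ y, g y • u t y = c t • eZ := fun t ht =>
    integral_smul_eq_smul_eZ_of_isAxisymmetric hgi hgrot (haxi t ht) (hmeas t ht) (hM t ht)
  have hcb : ∀ t < 0, |c t| ≤ M := by
    intro t ht
    have hint : Integrable fun y => g y * u t y 2 :=
      Integrable.mono' (hgi.norm.mul_const M) (hgi.aestronglyMeasurable.mul
        ((EuclideanSpace.proj (2 : Fin 3)).continuous.comp_aestronglyMeasurable (hmeas t ht)))
        (Eventually.of_forall fun y => by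
          rw [norm_mul]
          refine mul_le_mul_of_nonneg_left ?_ (norm_nonneg _)
          exact (by simpa using PiLp.norm_apply_le (u t y) 2 : ‖u t y 2‖ ≤ ‖u t y‖).trans (hM t ht y))
    calc |c t| = ‖∫ y, g y * u t y 2‖ := (Real.norm_eq_abs _).symm
      _ ≤ ∫ y, ‖g y‖ * M := norm_integral_le_of_norm_le (hgi.norm.mul_const M) (Eventually.of_forall fun y => by
          rw [norm_mul]
          refine mul_le_mul_of_nonneg_left ?_ (norm_nonneg _)
          exact (by simpa using PiLp.norm_apply_le (u t y) 2 : ‖u t y 2‖ ≤ ‖u t y‖).trans (hM t ht y))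
      _ = M := by
          rw [integral_mul_const]
          have : ∫ y, ‖g y‖ = 1 := by
            rw [← hg1]
            exact integral_congr_ae (Eventually.of_forall fun y => Real.norm_of_nonneg (hg0 y))
          rw [this, one_mul]
  -- (ii) the jointly measurable modification `w`, `u t = w t + c t e_z` a.e.
  obtain ⟨w, hw, ⟨B, hwB⟩, hwu⟩ :=
    hu.exists_modification_sub_average hν hmeas hgc hg.hasCompactSupport hg1
  have hwu' : ∀ t < 0, w t =ᵐ[volume] fun x => u t x - c t • eZ := fun t ht =>
    (hwu t ht).trans (Eventually.of_forall fun x => by simp only [havg t ht])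
  have huw : ∀ t < 0, u t =ᵐ[volume] fun x => w t x + c t • eZ := fun t ht => by
    filter_upwards [hwu' t ht] with x hx
    rw [hx, sub_add_cancel]
  have hwm : ∀ t, AEStronglyMeasurable (w t) volume := fun t =>
    (hw.comp_measurable measurable_prodMk_left).aestronglyMeasurable
  have hwdiv : ∀ t < 0, IsWeaklyDivFree (w t) := fun t ht =>
    isWeaklyDivFree_of_ae_eq_add_const (hu.1.1 t ht) (hmeas t ht) (hM t ht) (-(c t • eZ))
      ((hwu' t ht).trans (Eventually.of_forall fun x => by simp only [sub_eq_add_neg]))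
  -- (iii) `u' = w + c e_z`, a.e. equal to `u` slice-wise
  set u' : ℝ → EuclideanSpace ℝ (Fin 3) → EuclideanSpace ℝ (Fin 3) := fun t x => w t x + c t • eZ with hu'_def
  have hu'u : ∀ t < 0, u' t =ᵐ[volume] u t := fun t ht => (huw t ht).symm
  have heZ : ‖(eZ : EuclideanSpace ℝ (Fin 3))‖ = 1 := by simp [eZ]
  have hu'M : ∀ t < 0, ∀ x, ‖u' t x‖ ≤ B + M := fun t ht x =>
    (norm_add_le _ _).trans (add_le_add (hwB t x) (by rw [norm_smul, heZ, mul_one, Real.norm_eq_abs]; exact hcb t ht))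
  have hu'sol : IsBoundedAncientMildSolution 1 u' := hu.congr_ae_slice hu'u ⟨B + M, fun t ht x => hu'M t ht x⟩
  have hu'meas : ∀ t < 0, AEStronglyMeasurable (u' t) volume := fun t _ => (hwm t).add aestronglyMeasurable_const
  -- (v) a countable dense family of solenoidal tests; the cross terms `m` and their zero sets
  obtain ⟨φs, hφs, hdense⟩ := exists_seq_isDivFree_dense (E := EuclideanSpace ℝ (Fin 3))
  have hm_meas : ∀ (q : ℝ) (k : ℕ), Measurable fun τ =>
      ∫ x, ⟪w τ x, fderiv ℝ (heatTest 1 (φs k) (q - τ)) x eZ⟫ := fun q k =>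
    measurable_integral_inner_fderiv_heatTest_apply hw (hφs k).1 1 q eZ
  -- honest rational final times: non-constant slices
  set H : Set ℚ := {q | (q : ℝ) < 0 ∧ ∀ κ : EuclideanSpace ℝ (Fin 3), ¬ (u q =ᵐ[volume] fun _ => κ)} with hH_def
  set A : ℚ → ℕ → Set ℝ := fun q k =>
    {τ | τ < q ∧ (∫ x, ⟪w τ x, fderiv ℝ (heatTest 1 (φs k) (q - τ)) x eZ⟫) ≠ 0} with hA_def
  have hAm : ∀ q k, MeasurableSet (A q k) := fun q k =>
    measurableSet_Iio.inter ((hm_meas q k) (measurableSet_singleton (0 : ℝ)).compl)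
  set Gd : Set ℝ := ⋃ p : H × ℕ, A p.1 p.2 with hGd_def
  have hGm : MeasurableSet Gd := MeasurableSet.iUnion fun p => hAm _ _
  have hGd0 : Gd ⊆ Iio 0 := by
    intro τ hτ
    obtain ⟨p, hp⟩ := mem_iUnion.1 hτ
    exact lt_trans hp.1 p.1.2.1
  -- (iv)+(vii) `c` is a.e. measurable on `Gd`
  have hcA : ∀ (q : H) (k : ℕ), AEMeasurable c (volume.restrict (A q k)) := by
    intro q k
    have hq0 : ((q : ℚ) : ℝ) < 0 := q.2.1
    set qr : ℝ := ((q : ℚ) : ℝ) with hqr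
    -- the three functions of `τ`
    set Gf : ℝ → ℝ := fun τ => ∫ x, ⟪u τ x, convect (u τ) (heatTest 1 (φs k) (qr - τ)) x⟫ with hGf
    set Nf : ℝ → ℝ := fun τ => ∫ x, ⟪w τ x, fderiv ℝ (heatTest 1 (φs k) (qr - τ)) x (w τ x)⟫ with hNf
    set mf : ℝ → ℝ := fun τ => ∫ x, ⟪w τ x, fderiv ℝ (heatTest 1 (φs k) (qr - τ)) x eZ⟫ with hmf
    have hNm : Measurable Nf := measurable_integral_inner_fderiv_heatTest_self hw (hφs k).1 1 qr
    have hmm : Measurable mf := hm_meas qr k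
    -- the splitting `G = N + c m` at every `τ < 0`
    have hsplit : ∀ τ < 0, Gf τ = Nf τ + c τ * mf τ := by
      intro τ hτ
      have e1 : Gf τ = ∫ x, ⟪u' τ x, convect (u' τ) (heatTest 1 (φs k) (qr - τ)) x⟫ :=
        integral_inner_convect_heatTest_congr_ae (huw τ hτ) _
      rw [e1]
      simpa only [hu'_def, hNf, hmf, convect_apply] using
        integral_inner_convect_heatTest_add_const (hwm τ) (hwB τ) (hwdiv τ hτ) (c τ) eZ (hφs k).1 1 (qr - τ)
    -- honesty at `q`: `G` is integrable on every `(s, q)`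
    have hGint : ∀ s < qr, IntervalIntegrable Gf volume s qr := fun s hs =>
      hu.intervalIntegrable_nonlinear_of_not_ae_const hν hmeas hq0 q.2.2 hs (hφs k).1 (hφs k).2
    -- `c m = G - N` is a.e. measurable on every `(s, q)`, hence on `Iio q`
    have hcm_s : ∀ s < qr, AEMeasurable (fun τ => c τ * mf τ) (volume.restrict (Ioo s qr)) := by
      intro s hs
      have hGae : AEMeasurable Gf (volume.restrict (Ioo s qr)) :=
        ((hGint s hs).def'.mono_set (by rw [uIoc_of_le hs.le]; exact Ioo_subset_Ioc_self)).aestronglyMeasurable.aemeasurable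
      refine (hGae.sub hNm.aemeasurable).congr ?_
      refine (ae_restrict_mem measurableSet_Ioo).mono fun τ hτ => ?_
      have hτ0 : τ < 0 := hτ.2.trans hq0
      show Gf τ - Nf τ = c τ * mf τ
      rw [hsplit τ hτ0]
      ring
    have hcm : AEMeasurable (fun τ => c τ * mf τ) (volume.restrict (Iio qr)) := by
      have hcover : Iio qr = ⋃ n : ℕ, Ioo (qr - ((n : ℝ) + 1)) qr := by
        ext τ
        simp only [mem_Iio, mem_iUnion, mem_Ioo]
        constructor
        · intro hτ
          obtain ⟨n, hn⟩ := exists_nat_gt (qr - τ)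
          exact ⟨n, by linarith, hτ⟩
        · rintro ⟨n, -, hn2⟩
          exact hn2
      rw [hcover]
      exact aemeasurable_iUnion_iff.2 fun n => hcm_s _ (by linarith)
    -- on `A q k`, `m ≠ 0` and `c = (c m) / m`
    have hAsub : A q k ⊆ Iio qr := fun τ hτ => hτ.1
    have hcmA : AEMeasurable (fun τ => c τ * mf τ) (volume.restrict (A q k)) :=
      hcm.mono_measure (Measure.restrict_mono hAsub le_rfl)
    refine ((hcmA.div hmm.aemeasurable).congr ?_)
    refine (ae_restrict_mem (hAm q k)).mono fun τ hτ => ?_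
    show c τ * mf τ / mf τ = c τ
    exact mul_div_cancel_right₀ _ hτ.2
  have hcG : AEMeasurable c (volume.restrict Gd) := aemeasurable_iUnion_iff.2 fun p => hcA p.1 p.2
  -- the measurable, bounded substitute `ct` of `c`: `ct = c` a.e. on `Gd`, `ct = 0` off `Gd`
  set c₁ : ℝ → ℝ := hcG.mk c with hc₁_def
  have hc₁m : Measurable c₁ := hcG.measurable_mk
  have hcc₁ : ∀ᵐ τ ∂(volume.restrict Gd), c τ = c₁ τ := hcG.ae_eq_mk
  set ct : ℝ → ℝ := Gd.indicator fun τ => max (-M) (min M (c₁ τ)) with hct_def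
  have hctm : Measurable ct := (measurable_const.max (measurable_const.min hc₁m)).indicator hGm
  have hclip : ∀ y : ℝ, |max (-M) (min M y)| ≤ M := fun y =>
    abs_le.2 ⟨le_max_left _ _, max_le (by linarith) (min_le_left _ _)⟩
  have hctb : ∀ τ, |ct τ| ≤ M := by
    intro τ
    by_cases hτ : τ ∈ Gd
    · rw [hct_def, indicator_of_mem hτ]; exact hclip _
    · rw [hct_def, indicator_of_notMem hτ, abs_zero]; exact hM0
  have hct_on : ∀ᵐ τ ∂(volume : Measure ℝ), τ ∈ Gd → ct τ = c τ := by
    have h1 : ∀ᵐ τ ∂(volume : Measure ℝ), τ ∈ Gd → c τ = c₁ τ := (ae_restrict_iff' hGm).1 hcc₁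
    filter_upwards [h1] with τ hτ hmem
    have hc0 : |c τ| ≤ M := hcb τ (hGd0 hmem)
    rw [hct_def, indicator_of_mem hmem, ← hτ hmem]
    rw [abs_le] at hc0
    rw [min_eq_right hc0.2, max_eq_right hc0.1]
  -- (viii) off `Gd` the slices are invariant under the vertical translations
  have hinv_off : ∀ τ < 0, τ ∉ Gd → ∀ h : ℝ,
      (fun x => u τ (x + h • eZ)) =ᵐ[volume] u τ := by
    intro τ hτ hτG
    refine ae_eq_comp_add_smul_of_forall_integral_inner_fderiv_eq_zero (hmeas τ hτ) (hM τ hτ) (hu.1.1 τ hτ)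
      (fun φ hφ hdivφ => ?_)
    have hφ1 : ContDiff ℝ 1 φ := hφ.contDiff.of_le (by exact_mod_cast le_top)
    by_cases hacc : ∀ ε > (0 : ℝ), ∃ q : ℚ, q ∈ H ∧ τ < q ∧ (q : ℝ) < τ + ε
    · -- honest rational final times accumulate at `τ⁺`
      choose q hqH hτq hqε using fun n : ℕ => hacc (1 / ((n : ℝ) + 1)) (by positivity)
      have hσpos : ∀ n, 0 < (q n : ℝ) - τ := fun n => sub_pos.2 (hτq n)
      have hσ : Tendsto (fun n => (q n : ℝ) - τ) atTop (𝓝 0) := by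
        refine squeeze_zero (fun n => (hσpos n).le) (fun n => ?_) tendsto_one_div_add_atTop_nhds_zero_nat
        linarith [hqε n]
      -- `m^{qₙ}_k(τ) = 0`: otherwise `τ ∈ Gd`
      have hm0 : ∀ n k, ∫ x, ⟪w τ x, fderiv ℝ (heatTest 1 (φs k) ((q n : ℝ) - τ)) x eZ⟫ = 0 := by
        intro n k
        by_contra hne
        exact hτG (mem_iUnion.2 ⟨⟨⟨q n, hqH n⟩, k⟩, hτq n, hne⟩)
      -- transfer from `w τ` to `u τ = w τ + c τ e_z`
      have htrans : ∀ ψ : EuclideanSpace ℝ (Fin 3) → EuclideanSpace ℝ (Fin 3),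
          FunctionSpaces.IsTestFunctionOn (⊤ : Opens (EuclideanSpace ℝ (Fin 3))) ψ → ∀ σ : ℝ,
          ∫ x, ⟪u τ x, fderiv ℝ (heatTest 1 ψ σ) x eZ⟫ = ∫ x, ⟪w τ x, fderiv ℝ (heatTest 1 ψ σ) x eZ⟫ := by
        intro ψ hψ σ
        have hψ1 : ContDiff ℝ 1 ψ := hψ.contDiff.of_le (by exact_mod_cast le_top)
        have hDc : Continuous fun z => fderiv ℝ ψ z eZ := (hψ1.continuous_fderiv one_ne_zero).clm_apply continuous_const
        have hDi : Integrable fun x => fderiv ℝ (heatTest 1 ψ σ) x eZ := by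
          have : Integrable (heatFlow (fun z => fderiv ℝ ψ z eZ) (1 * σ)) :=
            integrable_heatFlow (hDc.integrable_of_hasCompactSupport (hψ.hasCompactSupport.fderiv_apply (𝕜 := ℝ) eZ)) _
          exact this.congr (Eventually.of_forall fun x => (fderiv_heatFlow_apply hψ1 hψ.hasCompactSupport _ x eZ).symm)
        have i1 : Integrable fun x => ⟪w τ x, fderiv ℝ (heatTest 1 ψ σ) x eZ⟫ :=
          integrable_inner_of_aestronglyMeasurable_of_norm_le (hwm τ) (hwB τ) hDi
        have i2 : Integrable fun x => ⟪c τ • eZ, fderiv ℝ (heatTest 1 ψ σ) x eZ⟫ := hDi.const_inner _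
        have h0 : ∫ x, ⟪c τ • eZ, fderiv ℝ (heatTest 1 ψ σ) x eZ⟫ = 0 :=
          integral_inner_const_fderiv_heatFlow_eq_zero hψ1 hψ.hasCompactSupport (1 * σ) (c τ • eZ) eZ
        calc ∫ x, ⟪u τ x, fderiv ℝ (heatTest 1 ψ σ) x eZ⟫
            = ∫ x, (⟪w τ x, fderiv ℝ (heatTest 1 ψ σ) x eZ⟫ + ⟪c τ • eZ, fderiv ℝ (heatTest 1 ψ σ) x eZ⟫) :=
              integral_congr_ae (by filter_upwards [huw τ hτ] with x hx; rw [hx, inner_add_left])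
          _ = ∫ x, ⟪w τ x, fderiv ℝ (heatTest 1 ψ σ) x eZ⟫ := by rw [integral_add i1 i2, h0, add_zero]
      have hzero_u : ∀ n k, ∫ x, ⟪u τ x, fderiv ℝ (heatTest 1 (φs k) ((q n : ℝ) - τ)) x eZ⟫ = 0 :=
        fun n k => by rw [htrans _ (hφs k).1, hm0]
      have hall : ∀ n, ∫ x, ⟪u τ x, fderiv ℝ (heatTest 1 φ ((q n : ℝ) - τ)) x eZ⟫ = 0 := fun n =>
        integral_inner_fderiv_heatTest_eq_zero_of_dense (hmeas τ hτ) (hM τ hτ) hφs hdense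
          (by simpa using hσpos n) (hzero_u n) hφ hdivφ
      exact integral_inner_fderiv_eq_zero_of_tendsto (hmeas τ hτ) (hM τ hτ) hν hσpos hσ hφ hall
    · -- the a.e.-constant rational slices accumulate at `τ⁺`: `u τ` is itself a.e. constant
      push Not at hacc
      obtain ⟨ε, hε, hfar⟩ := hacc
      have hδ : 0 < min ε (-τ) := lt_min hε (by linarith)
      -- rationals `r n ∈ (τ, τ + min ε (-τ) / (n + 2))`
      have hr : ∀ n : ℕ, ∃ r : ℚ, τ < r ∧ (r : ℝ) < τ + min ε (-τ) / ((n : ℝ) + 2) := fun n =>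
        exists_rat_btwn (lt_add_of_pos_right τ (by positivity))
      choose r hτr hrδ using hr
      have hr0 : ∀ n, (r n : ℝ) < 0 := by
        intro n
        have h1 : min ε (-τ) / ((n : ℝ) + 2) ≤ min ε (-τ) / 2 :=
          div_le_div_of_nonneg_left hδ.le (by norm_num) (by linarith [(Nat.cast_nonneg n : (0 : ℝ) ≤ n)])
        have h2 : min ε (-τ) ≤ -τ := min_le_right _ _
        linarith [hrδ n]
      have hrε : ∀ n, (r n : ℝ) < τ + ε := by
        intro n
        have h1 : min ε (-τ) / ((n : ℝ) + 2) ≤ min ε (-τ) / 1 :=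
          div_le_div_of_nonneg_left hδ.le one_pos (by linarith [(Nat.cast_nonneg n : (0 : ℝ) ≤ n)])
        have h2 : min ε (-τ) ≤ ε := min_le_left _ _
        linarith [hrδ n]
      -- these slices are a.e. constant (the `r n` are not honest)
      have hrconst : ∀ n, ∃ κ : EuclideanSpace ℝ (Fin 3), u (r n) =ᵐ[volume] fun _ => κ := by
        intro n
        by_contra hne
        push Not at hne
        have hmem : r n ∈ H := ⟨hr0 n, fun κ => hne κ⟩
        linarith [hfar (r n) hmem (hτr n), hrε n]
      have hrt : Tendsto (fun n => (r n : ℝ)) atTop (𝓝[Iio 0] τ) := by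
        refine tendsto_nhdsWithin_iff.2 ⟨?_, Eventually.of_forall hr0⟩
        have hup : Tendsto (fun n : ℕ => τ + min ε (-τ) / ((n : ℝ) + 2)) atTop (𝓝 τ) := by
          have h1 : Tendsto (fun n : ℕ => min ε (-τ) / ((n : ℝ) + 2)) atTop (𝓝 0) := by
            have := (tendsto_one_div_add_atTop_nhds_zero_nat.comp (tendsto_add_atTop_nat 1)).const_mul (min ε (-τ))
            rw [mul_zero] at this
            refine this.congr fun n => ?_
            simp only [Function.comp_apply, Nat.cast_add, Nat.cast_one]
            ring
          simpa using h1.const_add τ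
        exact tendsto_of_tendsto_of_tendsto_of_le_of_le tendsto_const_nhds hup (fun n => (hτr n).le) fun n => (hrδ n).le
      have hpair0 : ∀ θ : EuclideanSpace ℝ (Fin 3) → EuclideanSpace ℝ (Fin 3),
          FunctionSpaces.IsTestFunctionOn (⊤ : Opens (EuclideanSpace ℝ (Fin 3))) θ → VectorCalculus.IsDivFree θ →
          ∫ x, ⟪u τ x, θ x⟫ = 0 := by
        intro θ hθ hdivθ
        have hθ1 : ContDiff ℝ 1 θ := hθ.contDiff.of_le (by exact_mod_cast le_top)
        have hcont := hu.continuousOn_integral_inner hν hmeas hθ hdivθ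
        have hlim : Tendsto (fun n => ∫ x, ⟪u (r n) x, θ x⟫) atTop (𝓝 (∫ x, ⟪u τ x, θ x⟫)) :=
          (hcont τ hτ).tendsto.comp hrt
        have hvals : ∀ n, ∫ x, ⟪u (r n) x, θ x⟫ = 0 := by
          intro n
          obtain ⟨κ, hκ⟩ := hrconst n
          rw [integral_congr_ae (show (fun x => ⟪u (r n) x, θ x⟫) =ᵐ[volume] fun x => ⟪κ, θ x⟫ by
            filter_upwards [hκ] with x hx; rw [hx])]
          exact integral_inner_const_eq_zero_of_isDivFree κ hθ1 hθ.hasCompactSupport hdivθ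
        exact tendsto_nhds_unique hlim (tendsto_const_nhds.congr fun n => (hvals n).symm)
      obtain ⟨κ, hκ⟩ := IsWeaklyDivFree.exists_ae_eq_const_of_norm_le_of_forall_integral_inner_eq_zero
        (hmeas τ hτ) (hM τ hτ) (hu.1.1 τ hτ) hpair0
      have hDi : Integrable fun x => fderiv ℝ φ x eZ :=
        ((hφ1.continuous_fderiv one_ne_zero).clm_apply continuous_const).integrable_of_hasCompactSupport
          (hφ.hasCompactSupport.fderiv_apply (𝕜 := ℝ) eZ)
      calc ∫ x, ⟪u τ x, fderiv ℝ φ x eZ⟫ = ∫ x, ⟪κ, fderiv ℝ φ x eZ⟫ :=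
            integral_congr_ae (by filter_upwards [hκ] with x hx; rw [hx])
        _ = ⟪κ, ∫ x, fderiv ℝ φ x eZ⟫ := integral_inner hDi κ
        _ = 0 := by rw [integral_fderiv_apply_eq_zero hφ1 hφ.hasCompactSupport eZ, inner_zero_right]
  -- (ix) the drift lemma: `ũ = w + ct e_z = u' + (ct - c) e_z` is a bounded ancient mild solution
  set d : ℝ → ℝ := fun τ => ct τ - c τ with hd_def
  have hd : ∃ D : ℝ, ∀ t < 0, |d t| ≤ D := ⟨M + M, fun t ht =>
    (abs_sub _ _).trans (add_le_add (hctb t) (hcb t ht))⟩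
  have hinv : ∀ᵐ τ ∂((volume : Measure ℝ).restrict (Iio 0)),
      d τ = 0 ∨ ∀ h : ℝ, (fun x => u' τ (x + h • eZ)) =ᵐ[volume] u' τ := by
    filter_upwards [ae_restrict_of_ae (s := Iio (0 : ℝ)) hct_on, ae_restrict_mem measurableSet_Iio] with τ hτG hτ0
    by_cases hmem : τ ∈ Gd
    · left
      show ct τ - c τ = 0
      rw [hτG hmem, sub_self]
    · right
      intro h
      have e1 : (fun x => u' τ (x + h • eZ)) =ᵐ[volume] fun x => u τ (x + h • eZ) :=
        (measurePreserving_add_right volume (h • eZ)).quasiMeasurePreserving.ae_eq (hu'u τ hτ0)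
      exact e1.trans ((hinv_off τ hτ0 hmem h).trans (hu'u τ hτ0).symm)
  have hsol := hu'sol.add_timeConst_smul_of_ae_invariant hu'meas eZ hd hinv
  have hũ_eq : (fun t x => u' t x + d t • eZ) = fun t x => w t x + ct t • eZ := by
    funext t x
    simp only [hu'_def, hd_def, sub_smul]
    abel
  rw [hũ_eq] at hsol
  -- (x) `ũ` is a bounded weak solution, axisymmetric and swirl-free a.e.
  have hũjoint : AEStronglyMeasurable (uncurry fun t x => w t x + ct t • eZ)
      ((volume : Measure (ℝ × EuclideanSpace ℝ (Fin 3))).restrict (Iio 0 ×ˢ univ)) :=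
    (hw.add ((hctm.comp measurable_fst).stronglyMeasurable.smul_const eZ)).aestronglyMeasurable
  have hũsl : ∀ t < 0, AEStronglyMeasurable (fun x => w t x + ct t • eZ) volume := fun t _ =>
    (hwm t).add aestronglyMeasurable_const
  have hweak := hsol.isBoundedWeakNSSolutionOn hν hũjoint hũsl
  have hũU : ∀ t < 0, (fun x => w t x + ct t • eZ) =ᵐ[volume] fun x => u t x + (ct t - c t) • eZ := fun t ht => by
    filter_upwards [hwu' t ht] with x hx
    rw [hx, sub_smul]
    abel
  have haxiU : ∀ t < 0, IsAxisymmetric fun x => u t x + (ct t - c t) • eZ := fun t ht =>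
    isAxisymmetric_add_smul_eZ (haxi t ht) _
  have hax : ∀ θ : ℝ, ∀ᵐ t ∂((volume : Measure ℝ).restrict (Iio 0)),
      (fun x => (fun x => w t x + ct t • eZ) (rotZ θ x)) =ᵐ[volume] fun x => rotZ θ ((fun x => w t x + ct t • eZ) x) := by
    intro θ
    filter_upwards [ae_restrict_mem measurableSet_Iio] with t ht
    have e1 : (fun x => (fun x => w t x + ct t • eZ) (rotZ θ x)) =ᵐ[volume]
        fun x => u t (rotZ θ x) + (ct t - c t) • eZ :=
      (measurePreserving_rotZ θ).quasiMeasurePreserving.ae_eq (hũU t ht)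
    have e2 : (fun x => rotZ θ ((fun x => w t x + ct t • eZ) x)) =ᵐ[volume]
        fun x => rotZ θ (u t x + (ct t - c t) • eZ) := by
      filter_upwards [hũU t ht] with x hx
      simp only [hx]
    have e3 : (fun x => u t (rotZ θ x) + (ct t - c t) • eZ) =ᵐ[volume]
        fun x => rotZ θ (u t x + (ct t - c t) • eZ) :=
      Eventually.of_forall fun x => haxiU t ht θ x
    exact e1.trans (e3.trans e2.symm)
  exact ⟨fun t x => w t x + ct t • eZ, hweak, hax, fun t ht => ⟨ct t - c t, hũU t ht⟩⟩

end Bridge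

/-! ### The smooth representative of a duality-form solution and its swirl -/

section Representative

/-- **The KNSS representative of a duality-form solution, slice by slice.** For a bounded ancient
mild solution `u` of Navier–Stokes (`ν = 1`, duality form) with measurable, pointwise
axisymmetric slices there are a smooth representative `U` (smooth axisymmetric slices; the §4
bounds (4.7) `‖∇ᵏU‖ ≤ C_k` and (4.8) `‖∇ᵏU(t) − ∇ᵏU(s)‖ ≤ L_k|t − s|` of KNSS 2009; the swirl
equation (5.10) for `Γ = swirl U` with the bounded measurable drift `U + β e_z`, off the axis, in
time-integrated form — `KNSS2009_regularity_axisymmetric_swirl_holds` applied to the bounded weak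
modification of `exists_boundedWeak_axisymmetric_modification`) and a bounded measurable `β` such
that `u(t) = U(t) + κ(t) e_z` a.e. for **every** `t < 0` (not only for a.e. `t`): the pairings of
`u` and of `U` with a solenoidal test field are continuous on `(−∞, 0)`
(`IsBoundedAncientMildSolution.continuousOn_integral_inner`; `U` is Lipschitz in time) and agree
for a.e. `t` (constants annihilate solenoidal tests, `integral_inner_const_eq_zero_of_isDivFree`),
hence for all `t` (`Measure.eqOn_open_of_ae_eq`); so `u(t) − U(t)` annihilates the solenoidal
tests and is a.e. a constant (KNSS's Lemma 3.1 in the weak form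
`IsWeaklyDivFree.exists_ae_eq_const_of_norm_le_of_forall_integral_inner_eq_zero`), which is axial
(`eq_smul_eZ_of_ae_eq_const_of_isAxisymmetric`). (Lei–Ren–Zhang 2019, §1 p. 4: "these solutions
are smooth in space-time if they are bounded", after KNSS 2009, §4.) [cite: KochNadirashviliSereginSverak2009, §4 (4.6)–(4.8) p. 8, (5.10) p. 10 and Lemma 3.1 p. 7] -/
theorem exists_knss_representative_of_isAxisymmetric {u : ℝ → EuclideanSpace ℝ (Fin 3) → EuclideanSpace ℝ (Fin 3)}
    (hu : IsBoundedAncientMildSolution 1 u) (hmeas : ∀ t < 0, AEStronglyMeasurable (u t) volume)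
    (haxi : ∀ t < 0, IsAxisymmetric (u t)) :
    ∃ (U : ℝ → EuclideanSpace ℝ (Fin 3) → EuclideanSpace ℝ (Fin 3)) (β : ℝ → ℝ),
      Measurable β ∧ (∃ C : ℝ, ∀ t, |β t| ≤ C) ∧ Measurable (uncurry U) ∧
      (∀ t < 0, ContDiff ℝ ∞ (U t)) ∧ (∀ t < 0, IsAxisymmetric (U t)) ∧
      (∀ k : ℕ, ∃ C : ℝ, ∀ t < 0, ∀ x, ‖iteratedFDeriv ℝ k (U t) x‖ ≤ C) ∧
      (∀ k : ℕ, ∃ L : ℝ, ∀ s < 0, ∀ t < 0, ∀ x,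
        ‖iteratedFDeriv ℝ k (U t) x - iteratedFDeriv ℝ k (U s) x‖ ≤ L * |t - s|) ∧
      (∀ x, cylRadius x ≠ 0 → ∀ s t : ℝ, s ≤ t → t < 0 →
        swirl (U t) x - swirl (U s) x =
          ∫ τ in s..t, ((Δ (swirl (U τ))) x - fderiv ℝ (swirl (U τ)) x (U τ x + β τ • eZ) -
            2 / cylRadius x * partialDeriv (eR x) (swirl (U τ)) x)) ∧
      ∀ t < 0, ∃ κ : ℝ, u t =ᵐ[volume] fun x => U t x + κ • eZ := by
  obtain ⟨v, hweak, hax, hvu⟩ := exists_boundedWeak_axisymmetric_modification hu hmeas haxi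
  obtain ⟨U, β, hβm, hβb, hUm, hrep, hsmooth, hdiv, haxiU, hbd, hlip, hswirlEq⟩ :=
    KNSS2009_regularity_axisymmetric_swirl_holds hweak hax
  refine ⟨U, β, hβm, hβb, hUm, hsmooth, haxiU, hbd, hlip, hswirlEq, ?_⟩
  intro t ht
  obtain ⟨M, hM'⟩ := hu.2
  have hM : ∀ t < 0, ∀ x, ‖u t x‖ ≤ M := fun t ht x => hM' t ht x
  have hν : (0 : ℝ) < 1 := one_pos
  obtain ⟨C0, hC0⟩ := hbd 0
  have hU0 : ∀ s < 0, ∀ x, ‖U s x‖ ≤ C0 := fun s hs x => by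
    have h := hC0 s hs x
    rwa [norm_iteratedFDeriv_zero] at h
  obtain ⟨L0, hL0⟩ := hlip 0
  have hUL : ∀ s < 0, ∀ s' < 0, ∀ x, ‖U s' x - U s x‖ ≤ L0 * |s' - s| := fun s hs s' hs' x => by
    have h := hL0 s hs s' hs' x
    rw [iteratedFDeriv_zero_eq_comp, iteratedFDeriv_zero_eq_comp, Function.comp_apply,
      Function.comp_apply, ← map_sub, LinearIsometryEquiv.norm_map] at h
    exact h
  have hUam : ∀ s < 0, AEStronglyMeasurable (U s) volume := fun s hs =>
    (hsmooth s hs).continuous.aestronglyMeasurable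
  -- the pairings of `u t` and `U t` with every solenoidal test agree
  have hpair : ∀ θ : EuclideanSpace ℝ (Fin 3) → EuclideanSpace ℝ (Fin 3), FunctionSpaces.IsTestFunctionOn (⊤ : Opens (EuclideanSpace ℝ (Fin 3))) θ →
      VectorCalculus.IsDivFree θ → ∫ x, ⟪u t x, θ x⟫ = ∫ x, ⟪U t x, θ x⟫ := by
    intro θ hθ hdivθ
    have hθ1 : ContDiff ℝ 1 θ := hθ.contDiff.of_le (by exact_mod_cast le_top)
    have hθi : Integrable θ :=
      hθ.contDiff.continuous.integrable_of_hasCompactSupport hθ.hasCompactSupport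
    have hi : ∀ r < 0, Integrable fun x => ⟪U r x, θ x⟫ := fun r hr =>
      integrable_inner_of_aestronglyMeasurable_of_norm_le (hUam r hr) (hU0 r hr) hθi
    -- both pairings are continuous on `(−∞, 0)`
    have hPu : ContinuousOn (fun s => ∫ x, ⟪u s x, θ x⟫) (Iio 0) :=
      hu.continuousOn_integral_inner hν hmeas hθ hdivθ
    have hQU : ContinuousOn (fun s => ∫ x, ⟪U s x, θ x⟫) (Iio 0) := by
      have hlipQ : LipschitzOnWith (L0 * ∫ x, ‖θ x‖).toNNReal (fun s => ∫ x, ⟪U s x, θ x⟫)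
          (Iio 0) := by
        refine LipschitzOnWith.of_dist_le_mul fun s hs s' hs' => ?_
        rw [Real.dist_eq, ← integral_sub (hi s hs) (hi s' hs')]
        calc |∫ x, (⟪U s x, θ x⟫ - ⟪U s' x, θ x⟫)|
            ≤ ∫ x, L0 * |s - s'| * ‖θ x‖ := by
              rw [← Real.norm_eq_abs]
              refine norm_integral_le_of_norm_le ((hθi.norm).const_mul _)
                (Eventually.of_forall fun x => ?_)
              rw [← inner_sub_left, Real.norm_eq_abs]
              calc |⟪U s x - U s' x, θ x⟫| ≤ ‖U s x - U s' x‖ * ‖θ x‖ := abs_real_inner_le_norm _ _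
                _ ≤ L0 * |s - s'| * ‖θ x‖ :=
                  mul_le_mul_of_nonneg_right (hUL s' hs' s hs x) (norm_nonneg _)
          _ = (L0 * ∫ x, ‖θ x‖) * |s - s'| := by rw [integral_const_mul]; ring
          _ ≤ ((L0 * ∫ x, ‖θ x‖).toNNReal : ℝ) * dist s s' := by
              rw [Real.dist_eq]
              exact mul_le_mul_of_nonneg_right (Real.le_coe_toNNReal _) (abs_nonneg _)
      exact hlipQ.continuousOn
    -- and they agree for a.e. `t < 0`
    have hae : (fun s => ∫ x, ⟪u s x, θ x⟫) =ᵐ[volume.restrict (Iio 0)]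
        fun s => ∫ x, ⟪U s x, θ x⟫ := by
      filter_upwards [hrep, ae_restrict_mem measurableSet_Iio] with s hs hs0
      obtain ⟨d, hd⟩ := hvu s hs0
      have h1 : (fun x => ⟪u s x, θ x⟫) =ᵐ[volume]
          fun x => ⟪U s x, θ x⟫ + ⟪(β s - d) • eZ, θ x⟫ := by
        filter_upwards [hs, hd] with x hx hx'
        have e : u s x = U s x + (β s - d) • eZ := by
          have e1 : u s x = v s x - d • eZ := by rw [hx']; simp
          rw [e1, hx, sub_smul]
          abel
        rw [e, inner_add_left]
      rw [integral_congr_ae h1, integral_add (hi s hs0) (hθi.const_inner _),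
        integral_inner_const_eq_zero_of_isDivFree _ hθ1 hθ.hasCompactSupport hdivθ, add_zero]
    exact Measure.eqOn_open_of_ae_eq hae isOpen_Iio hPu hQU ht
  -- so `u t - U t` annihilates the solenoidal tests; it is bounded, measurable, weakly
  -- divergence free, hence a.e. a constant, and the constant is axial
  have hwm : AEStronglyMeasurable (fun x => u t x - U t x) volume := (hmeas t ht).sub (hUam t ht)
  have hwb : ∀ x, ‖u t x - U t x‖ ≤ M + C0 := fun x =>
    (norm_sub_le _ _).trans (add_le_add (hM t ht x) (hU0 t ht x))
  have hwdiv : IsWeaklyDivFree fun x => u t x - U t x := by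
    intro θ hθ
    have hθ1 : ContDiff ℝ 1 θ := hθ.contDiff.of_le (by exact_mod_cast le_top)
    have hgi : Integrable (gradient θ) :=
      ((InnerProductSpace.toDual ℝ (EuclideanSpace ℝ (Fin 3))).symm.continuous.comp
        (hθ1.continuous_fderiv one_ne_zero)).integrable_of_hasCompactSupport
        ((hθ.hasCompactSupport.fderiv ℝ).comp_left
          (g := fun L => (InnerProductSpace.toDual ℝ (EuclideanSpace ℝ (Fin 3))).symm L) (map_zero _))
    have i1 : Integrable fun x => ⟪u t x, gradient θ x⟫ :=
      integrable_inner_of_aestronglyMeasurable_of_norm_le (hmeas t ht) (hM t ht) hgi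
    have i2 : Integrable fun x => ⟪U t x, gradient θ x⟫ :=
      integrable_inner_of_aestronglyMeasurable_of_norm_le (hUam t ht) (hU0 t ht) hgi
    have hUw : IsWeaklyDivFree (U t) :=
      VectorCalculus.IsDivFree.isWeaklyDivFree_holds (hdiv t ht)
        ((hsmooth t ht).of_le (by exact_mod_cast le_top))
    calc ∫ x, ⟪u t x - U t x, gradient θ x⟫
        = ∫ x, (⟪u t x, gradient θ x⟫ - ⟪U t x, gradient θ x⟫) := by simp_rw [inner_sub_left]
      _ = 0 := by rw [integral_sub i1 i2, hu.1.1 t ht θ hθ, hUw θ hθ, sub_zero]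
  have horth : ∀ φ : EuclideanSpace ℝ (Fin 3) → EuclideanSpace ℝ (Fin 3), FunctionSpaces.IsTestFunctionOn (⊤ : Opens (EuclideanSpace ℝ (Fin 3))) φ →
      VectorCalculus.IsDivFree φ → ∫ x, ⟪u t x - U t x, φ x⟫ = 0 := by
    intro φ hφ hdivφ
    have hφi : Integrable φ :=
      hφ.contDiff.continuous.integrable_of_hasCompactSupport hφ.hasCompactSupport
    have i1 : Integrable fun x => ⟪u t x, φ x⟫ :=
      integrable_inner_of_aestronglyMeasurable_of_norm_le (hmeas t ht) (hM t ht) hφi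
    have i2 : Integrable fun x => ⟪U t x, φ x⟫ :=
      integrable_inner_of_aestronglyMeasurable_of_norm_le (hUam t ht) (hU0 t ht) hφi
    calc ∫ x, ⟪u t x - U t x, φ x⟫ = ∫ x, (⟪u t x, φ x⟫ - ⟪U t x, φ x⟫) := by
          simp_rw [inner_sub_left]
      _ = 0 := by rw [integral_sub i1 i2, hpair φ hφ hdivφ, sub_self]
  obtain ⟨κ, hκ⟩ :=
    IsWeaklyDivFree.exists_ae_eq_const_of_norm_le_of_forall_integral_inner_eq_zero hwm hwb hwdiv horth
  have haxw : IsAxisymmetric fun x => u t x - U t x := fun θ' x => by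
    show u t (rotZ θ' x) - U t (rotZ θ' x) = rotZ θ' (u t x - U t x)
    rw [haxi t ht θ' x, haxiU t ht θ' x,
      show rotZ θ' (u t x - U t x) = rotZL θ' (u t x - U t x) from rfl, map_sub, rotZL_apply,
      rotZL_apply]
  have hκax := eq_smul_eZ_of_ae_eq_const_of_isAxisymmetric haxw hκ
  refine ⟨κ 2, ?_⟩
  filter_upwards [hκ] with x hx
  show u t x = U t x + κ 2 • eZ
  calc u t x = U t x + (u t x - U t x) := by abel
    _ = U t x + κ := by rw [hx]
    _ = U t x + κ 2 • eZ := by rw [← hκax]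

end Representative

/-! ### Lei–Ren–Zhang 2019, §4: the swirl supremum is approached at radial infinity -/

section Main

/-- **Lei–Ren–Zhang 2019, §1 p. 4 and §4 p. 10 (`leiRenZhang2019_swirl_sup_at_infinity`),
PROVED.** "If `v` is any bounded ancient solution such that `Γ` is bounded, then
`lim sup_{r→∞} Γ = sup Γ`" (arXiv:1902.11229, §1 p. 4; proof §4 p. 10, first observation of the
proof of Theorem 1.2), in the tree's rendering through positive-measure superlevel sets of `|Γ|`
on the slices of a duality-form bounded ancient mild solution. Proof: pass to the smooth KNSS
representative `U` (`exists_knss_representative_of_isAxisymmetric`: `swirl (u t) = swirl (U t)` a.e. for every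
`t < 0`), whose swirl `Γ = swirl U` is `C²` with `∇Γ`, `ΔΓ` jointly continuous (KNSS (4.8) and the
swirl calculus `fderiv_swirl_apply`, `laplacian_swirl`), satisfies `|Γ| ≤ r‖U‖ ≤ C₀ r`
(`abs_swirl_le_cylRadius_mul_norm`) and `|Γ| ≤ C` everywhere (an a.e. bound is an everywhere bound
for a continuous function), and solves the swirl equation with the bounded drift `U + β e_z`;
a level `ℓ` whose superlevel set `{ℓ < |swirl (u t₀)|}` has positive measure is `< M = sup |Γ|`;
the maximum-principle step (`exists_far_abs_gt_of_forall_exists_abs_gt`, KNSS Lemma 2.1 in place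
of the printed compactness argument) gives a point beyond radius `R + 1` with `|Γ| > ℓ`, around
which a small ball lies in `{r ≥ R} ∩ {ℓ < |Γ(t, ·)|}`, a set of positive measure, equal a.e. to
the corresponding set for `swirl (u t)`. [cite: LeiRenZhang2019, §1 p. 4 (statement) and §4 p. 10 (proof); ZhangPan2022, p. 12] -/
theorem leiRenZhang2019_swirl_sup_at_infinity_holds : leiRenZhang2019_swirl_sup_at_infinity := by
  intro u hu hmeas haxi hswirl ℓ R hlevel
  obtain ⟨C, hC⟩ := hswirl
  obtain ⟨t₀, ht₀, hpos⟩ := hlevel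
  obtain ⟨U, β, hβm, ⟨Bβ, hBβ⟩, hUm, hsmooth, haxiU, hbd, hlip, hswirlEq, hrepr⟩ :=
    exists_knss_representative_of_isAxisymmetric hu hmeas haxi
  -- the swirl of the representative agrees a.e. with the swirl of `u`, slice by slice
  set f : ℝ → EuclideanSpace ℝ (Fin 3) → ℝ := fun t => swirl (U t) with hf_def
  have hfu : ∀ t < 0, ∀ᵐ x ∂(volume : Measure (EuclideanSpace ℝ (Fin 3))), swirl (u t) x = f t x := by
    intro t ht
    obtain ⟨κ, hκ⟩ := hrepr t ht
    filter_upwards [hκ] with x hx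
    have h1 : swirl (u t) x = swirl (fun y => U t y + κ • eZ) x := by simp only [swirl, hx]
    rw [h1, swirl_add_smul_eZ]
  -- regularity of `f` (KNSS (4.8) and the swirl calculus)
  set S : Set (ℝ × EuclideanSpace ℝ (Fin 3)) := Iio 0 ×ˢ univ with hS
  have hU2 : ∀ t < 0, ContDiff ℝ 2 (U t) := fun t ht => (hsmooth t ht).of_le (by norm_cast)
  have hU1 : ∀ t < 0, ContDiff ℝ 1 (U t) := fun t ht => (hsmooth t ht).of_le (by norm_cast)
  have hUd : ∀ t < 0, ∀ x, DifferentiableAt ℝ (U t) x := fun t ht x =>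
    ((hU1 t ht).differentiable one_ne_zero) x
  have hD : ∀ k : ℕ, ContinuousOn (fun p : ℝ × EuclideanSpace ℝ (Fin 3) => iteratedFDeriv ℝ k (U p.1) p.2) S := by
    intro k
    obtain ⟨L, hL⟩ := hlip k
    exact continuousOn_iteratedFDeriv_of_lipschitz hsmooth hL
  have hUc : ContinuousOn (fun p : ℝ × EuclideanSpace ℝ (Fin 3) => U p.1 p.2) S := by
    have h := (ContinuousMultilinearMap.apply ℝ (fun _ : Fin 0 => EuclideanSpace ℝ (Fin 3)) (EuclideanSpace ℝ (Fin 3))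
      (Fin.elim0 : Fin 0 → EuclideanSpace ℝ (Fin 3))).continuous.comp_continuousOn (hD 0)
    refine h.congr fun p _ => ?_
    simp only [comp_apply, ContinuousMultilinearMap.apply_apply, iteratedFDeriv_zero_apply]
  have hD1c : ∀ y : EuclideanSpace ℝ (Fin 3), ContinuousOn (fun p : ℝ × EuclideanSpace ℝ (Fin 3) => fderiv ℝ (U p.1) p.2 y) S := by
    intro y
    have h := (ContinuousMultilinearMap.apply ℝ (fun _ : Fin 1 => EuclideanSpace ℝ (Fin 3)) (EuclideanSpace ℝ (Fin 3))
      (fun _ => y)).continuous.comp_continuousOn (hD 1)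
    refine h.congr fun p _ => ?_
    simp only [comp_apply, ContinuousMultilinearMap.apply_apply, iteratedFDeriv_one_apply]
  have hD2c : ∀ m : Fin 2 → EuclideanSpace ℝ (Fin 3),
      ContinuousOn (fun p : ℝ × EuclideanSpace ℝ (Fin 3) => iteratedFDeriv ℝ 2 (U p.1) p.2 m) S := fun m =>
    (ContinuousMultilinearMap.apply ℝ (fun _ : Fin 2 => EuclideanSpace ℝ (Fin 3)) (EuclideanSpace ℝ (Fin 3)) m).continuous.comp_continuousOn
      (hD 2)
  have hf2 : ∀ t < 0, ContDiff ℝ 2 (f t) := fun t ht => contDiff_swirl (hU2 t ht)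
  have hDf : ContinuousOn (fun p : ℝ × EuclideanSpace ℝ (Fin 3) => fderiv ℝ (f p.1) p.2) S := by
    refine continuousOn_clm_apply.2 fun y => ?_
    have hG : ContinuousOn
        (fun p : ℝ × EuclideanSpace ℝ (Fin 3) => ⟪rotGen p.2, fderiv ℝ (U p.1) p.2 y⟫ + ⟪rotGen y, U p.1 p.2⟫) S :=
      ((rotGenL.continuous.comp continuous_snd).continuousOn.inner (hD1c y)).add
        (continuousOn_const.inner hUc)
    refine hG.congr fun p hp => ?_
    exact fderiv_swirl_apply (hUd p.1 hp.1 p.2) y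
  have hΔf : ContinuousOn (fun p : ℝ × EuclideanSpace ℝ (Fin 3) => (Δ (f p.1)) p.2) S := by
    classical
    set bs := EuclideanSpace.basisFun (Fin 3) ℝ with hbs
    have hΔU : ContinuousOn (fun p : ℝ × EuclideanSpace ℝ (Fin 3) => (Δ (U p.1)) p.2) S := by
      have h : ContinuousOn
          (fun p : ℝ × EuclideanSpace ℝ (Fin 3) => ∑ i, iteratedFDeriv ℝ 2 (U p.1) p.2 ![bs i, bs i]) S :=
        continuousOn_finsetSum _ fun i _ => hD2c _
      refine h.congr fun p _ => ?_
      exact congrFun (laplacian_eq_iteratedFDeriv_orthonormalBasis (U p.1) bs) p.2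
    have hG : ContinuousOn (fun p : ℝ × EuclideanSpace ℝ (Fin 3) => ⟪rotGen p.2, (Δ (U p.1)) p.2⟫ +
        2 * (fderiv ℝ (U p.1) p.2 (EuclideanSpace.single 0 1) 1 -
          fderiv ℝ (U p.1) p.2 (EuclideanSpace.single 1 1) 0)) S :=
      ((rotGenL.continuous.comp continuous_snd).continuousOn.inner hΔU).add
        (continuousOn_const.mul
          (((PiLp.continuous_apply 2 _ 1).comp_continuousOn (hD1c _)).sub
            ((PiLp.continuous_apply 2 _ 0).comp_continuousOn (hD1c _))))
    refine hG.congr fun p hp => ?_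
    exact laplacian_swirl (hU2 p.1 hp.1) p.2
  -- bounds: `|f| ≤ C₀ r`, `|f| ≤ C` (a.e. on every slice, hence everywhere), `‖U + β e_z‖ ≤ C₀ + B`
  obtain ⟨C0, hC0⟩ := hbd 0
  have hU0 : ∀ t < 0, ∀ x, ‖U t x‖ ≤ C0 := fun t ht x => by
    have h := hC0 t ht x
    rwa [norm_iteratedFDeriv_zero] at h
  have haxis : ∀ t < 0, ∀ x, |f t x| ≤ cylRadius x * C0 := fun t ht x =>
    (abs_swirl_le_cylRadius_mul_norm (U t) x).trans
      (mul_le_mul_of_nonneg_left (hU0 t ht x) (cylRadius_nonneg x))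
  have hfC : ∀ t < 0, ∀ x, |f t x| ≤ C := by
    intro t ht
    have hae : ∀ᵐ x ∂(volume : Measure (EuclideanSpace ℝ (Fin 3))), |f t x| ≤ C := by
      filter_upwards [hfu t ht] with x hx
      rw [← hx]
      exact hC t ht x
    have hcont : Continuous fun x => |f t x| := (hf2 t ht).continuous.abs
    have h := SereginSverak2009.forall_le_of_ae_le_of_continuousOn isOpen_univ hcont.continuousOn
      continuousOn_const (by rwa [Measure.restrict_univ])
    exact fun x => h x (mem_univ x)
  have hb : Measurable (uncurry fun t x => U t x + β t • eZ) :=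
    hUm.add ((hβm.comp measurable_fst).smul_const eZ)
  have hB : ∀ t < 0, ∀ x, ‖U t x + β t • eZ‖ ≤ C0 + Bβ := fun t ht x => by
    refine (norm_add_le _ _).trans (add_le_add (hU0 t ht x) ?_)
    rw [norm_smul, Real.norm_eq_abs]
    have : ‖(eZ : EuclideanSpace ℝ (Fin 3))‖ = 1 := by simp [eZ]
    rw [this, mul_one]
    exact hBβ t
  -- the supremum `M` of `|f|` over `(−∞, 0) × ℝ³`
  set Sv : Set ℝ := {w | ∃ t < 0, ∃ x, |f t x| = w} with hSv
  have hbdd : BddAbove Sv := ⟨C, by rintro w ⟨t, ht, x, rfl⟩; exact hfC t ht x⟩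
  have hne : Sv.Nonempty := ⟨|f (-1) 0|, -1, by norm_num, 0, rfl⟩
  set M : ℝ := sSup Sv with hM_def
  have hM : ∀ t < 0, ∀ x, |f t x| ≤ M := fun t ht x => le_csSup hbdd ⟨t, ht, x, rfl⟩
  have happr : ∀ η > 0, ∃ t < 0, ∃ x, M - η < |f t x| := by
    intro η hη
    obtain ⟨w, ⟨t, ht, x, rfl⟩, hw⟩ := exists_lt_of_lt_csSup hne (by linarith : M - η < M)
    exact ⟨t, ht, x, hw⟩
  -- `ℓ < M`: the superlevel set of `|f t₀|` at level `ℓ` has positive measure, so is nonempty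
  have hℓM : ℓ < M := by
    have hle : volume {x | ℓ < |swirl (u t₀) x|} ≤ volume {x | ℓ < |f t₀ x|} := by
      refine measure_mono_ae ?_
      filter_upwards [hfu t₀ ht₀] with x hx h
      show ℓ < |f t₀ x|
      rw [← hx]
      exact h
    obtain ⟨x, hx⟩ := nonempty_of_measure_ne_zero (lt_of_lt_of_le hpos hle).ne'
    exact lt_of_lt_of_le hx (hM t₀ ht₀ x)
  -- the maximum-principle step: `|f| > ℓ` somewhere beyond radius `R + 1`
  obtain ⟨t, ht, x₁, hx₁R, hx₁ℓ⟩ := exists_far_abs_gt_of_forall_exists_abs_gt hf2 hDf hΔf haxis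
    hb hB hswirlEq hM hℓM happr (R + 1)
  -- a small ball around that point lies in `{r ≥ R} ∩ {ℓ < |f t|}`
  have hopen : IsOpen {y : EuclideanSpace ℝ (Fin 3) | ℓ < |f t y|} := isOpen_lt continuous_const (hf2 t ht).continuous.abs
  obtain ⟨ρ, hρ, hball⟩ := Metric.isOpen_iff.1 hopen x₁ hx₁ℓ
  set ρ' : ℝ := min ρ 1 with hρ'
  have hρ'pos : 0 < ρ' := lt_min hρ one_pos
  have hsub : Metric.ball x₁ ρ' ⊆ {y : EuclideanSpace ℝ (Fin 3) | R ≤ cylRadius y ∧ ℓ < |f t y|} := by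
    intro y hy
    have hy' : dist y x₁ < ρ' := hy
    refine ⟨?_, hball (Metric.ball_subset_ball (min_le_left _ _) hy)⟩
    have h1 : cylRadius x₁ ≤ cylRadius y + ‖x₁ - y‖ := cylRadius_le_cylRadius_add_norm_sub y x₁
    have h2 : ‖x₁ - y‖ < 1 := by
      rw [← dist_eq_norm, dist_comm]
      exact lt_of_lt_of_le hy' (min_le_right _ _)
    linarith
  have hposf : 0 < volume {y : EuclideanSpace ℝ (Fin 3) | R ≤ cylRadius y ∧ ℓ < |f t y|} :=
    lt_of_lt_of_le (Metric.measure_ball_pos volume x₁ hρ'pos) (measure_mono hsub)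
  -- transfer back to `swirl (u t)`
  refine ⟨t, ht, lt_of_lt_of_le hposf (measure_mono_ae ?_)⟩
  filter_upwards [hfu t ht] with y hy h
  exact ⟨h.1, by rw [hy]; exact h.2⟩

end Main

end Literature.Analysis.FluidPDE
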